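/-
Origin: expansion seat `planner-pub-hodgecm-prl2-g4-0`, handover #2 2026-08-18T05:45:50Z (`HOME/pub-hodgecm-prl2-g4/lean/Prl2g4/PairingShadow.lean`, md5 4b35831f, 136 lines);
landed by the gen-6 packager in gate run 23 as `HodgeCM/Model/PairingShadow.lean` (import ^import Prl2g4\.→import HodgeCM.StubTree. ×1).
-/
/-
Origin: HOME/pub-hodgecm-prl2-g4/lean/Prl2g4/PairingShadow.lean — session planner-pub-hodgecm-prl2-g4-0 (unit pub-hodgecm-prl2-g4,
gen 4 of expansion prover a-2).  Intended final place: `HodgeCM/Model/PairingShadow.lean`; the WIP import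
`Prl2g4.PairingReduction` becomes `HodgeCM.StubTree.PairingReduction` at intake.  Companion (honesty / non-vacuity) to
`PairingReduction.lean`, in the style of `HodgeCM.Model.NonVacuity` §2 (separating the period content of a reduced
record by the period-free shadow `U.periodFree`).  Kernel only; nothing posited, nothing cited.
-/
import Summits.HodgeConjecture.HodgeCM.StubTree.PairingReduction_2
import Summits.HodgeConjecture.HodgeCM.Model.Inhabited

/-!
# Where the period content of the isotypic package sits: the period-free shadow

`U⁰ := U.periodFree` (`HodgeCM.Model.PeriodFree`: all primitives of `U` except `tr := 0`).  For the isotypic package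
(I0)–(I6) ∧ THE OBSTRUCTION of `HodgeCM.StubTree.PairingReduction`:

* `periodFree_pair2` — over `U⁰` the sesquilinear pairing `⟨c, d⟩ = ∫ c ∪ \bar d` is identically zero; hence
  `periodFree_ortho`, `periodFree_expand`: (I2) and (I6) hold for EVERY datum over `U⁰` (they are period-free), and
  (I0), (I1), (I3), (I4) do not mention the trace at all;
* `periodFree_translate_iff` — over `U⁰`, (I5) `Translate` holds iff NO constituent has a nonzero fixed vector in
  `F²H²` at any level; so `periodFree_F2_eq_zero_of_standard`: a datum satisfying (I0)–(I6) over `U⁰` forces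
  `F²H²(P_Γ) = 0` at every level — (I5) (multiplicity one + Petersson-is-cup + non-vanishing matrix coefficients) is
  the ONE clause of the seven through which the period enters, exactly as `Fact_innerEmb` / `Fact_hodgeRiemann20` are
  for the theta record (`NonVacuity.separating_theta`);
* `periodFree_not_liu_isoFree` — consequently over `U⁰` the hypotheses of the Venkataramana-free headline
  `COR_CM_of_liu_isoFree` minus Pohlmann/QW8 (model facts, Liu supply, `IsoFreePerL`) are jointly CONTRADICTORY once
  PerL's hypotheses are inhabited (and the face version outright, `faceHypothesesInhabited`): the package is not
  satisfiable where the conclusion `PerL44` / `PeriodThmF` is false — it carries the period content, it does not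
  smuggle it.  (Equivalently: `perL44_of_liu_isoFree` composed with `periodFree_perL44_iff`.)
-/

noncomputable section

open scoped BigOperators

namespace HodgeCM

namespace Universe

open Literature.AlgebraicGeometry.Motives

variable (U : Universe)

/-- Over the period-free shadow the sesquilinear cup pairing vanishes identically. -/
@[simp] theorem periodFree_pair2 (X : U.Var) (c d : U.CohC X 2) : U.periodFree.pair2 X c d = 0 := by
  change U.periodFree.trC X 4 _ = 0
  rw [periodFree_trC, LinearMap.zero_apply]

variable {U} {L : CMField} {ι₁ : L →+* ℂ} {V : HermSpace3 L ι₁}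

/-- (I2) is period-free: it holds for every datum over `U⁰`. -/
theorem periodFree_ortho (D : U.periodFree.IsoDatum V) : D.Ortho := by
  intro Γ π π' c d _ _ _
  exact U.periodFree_pair2 _ _ _

/-- (I6) is period-free: it holds for every datum over `U⁰` (with the empty family of correspondences). -/
theorem periodFree_expand (D : U.periodFree.IsoDatum V) : D.Expand := by
  intro π Γ
  refine ⟨0, Fin.elim0, fun k => k.elim0, fun k => k.elim0, Fin.elim0, ?_⟩
  intro x y _ _
  simp

/-- Over `U⁰`, (I5) says exactly: no constituent has a nonzero fixed vector in `F²H²` at any level. -/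
theorem periodFree_translate_iff (D : U.periodFree.IsoDatum V) (Hk : U.periodFree.HeckeData) :
    D.Translate Hk ↔
      ∀ (π : D.A) (Γ : Level V) (c : U.periodFree.CohC (U.periodFree.pms L ι₁ V Γ) 2),
        c ∈ U.periodFree.F2 Γ → D.proj Γ π c = c → c = 0 := by
  constructor
  · intro h π Γ c hc hfix
    by_contra hne
    obtain ⟨Γ'', F, -, G, -, hpair⟩ := h π Γ Γ c c hc hc hfix hfix hne hne
    exact hpair (U.periodFree_pair2 _ _ _)
  · intro h π Γ Γ' c d hc _ hfix _ hne _
    exact absurd (h π Γ c hc hfix) hne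

/-- **Separation.**  A datum satisfying (I0)–(I6) over the period-free shadow forces `F²H²(P_Γ) = 0` at every level:
the period content of the package enters through (I5). -/
theorem periodFree_F2_eq_zero_of_standard (D : U.periodFree.IsoDatum V) {Hk : U.periodFree.HeckeData}
    (hS : D.Standard Hk) (Γ : Level V) {c : U.periodFree.CohC (U.periodFree.pms L ι₁ V Γ) 2}
    (hc : c ∈ U.periodFree.F2 Γ) : c = 0 := by
  have h0 : ∀ π : D.A, D.proj Γ π c = 0 := fun π =>
    (periodFree_translate_iff D Hk).mp hS.translate π Γ (D.proj Γ π c) (hS.projMem Γ π c hc) (hS.idem Γ π c hc)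
  obtain ⟨s, -, hsum⟩ := hS.decomp Γ c hc
  rw [hsum]
  exact Finset.sum_eq_zero fun π _ => h0 π

/-- Hence over `U⁰` no datum satisfying (I0)–(I6) meets any constituent with any wedge. -/
theorem periodFree_not_meets (D : U.periodFree.IsoDatum V) {Hk : U.periodFree.HeckeData} (hS : D.Standard Hk)
    (M : U.ModelAxioms) (π : D.A) (K : CMField) (Ψa Ψb : CMType K) (σ : K →+* ℂ) : ¬ D.Meets π K Ψa Ψb σ := by
  rintro ⟨Γ, ωa, ωb, ha, hb, hne⟩
  have hH := M.periodFree.pull_hodge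
  have hF : U.periodFree.cup2C _ 1 ωa ωb ∈ U.periodFree.F2 Γ :=
    cup2C_mem_F2' M.periodFree.cup2_hodge _ (Uiso_le_H10 hH Γ K Ψa σ ha) (Uiso_le_H10 hH Γ K Ψb σ hb)
  exact hne (by rw [periodFree_F2_eq_zero_of_standard D hS Γ hF, map_zero])

variable (U)

/-- **The isotypic package is contradictory in the period-free shadow (PerL binders)**: model facts, Liu supply and
`IsoFreePerL` cannot hold together over `U⁰` once PerL's hypotheses are inhabited — because they prove `PerL44`
(`perL44_of_liu_isoFree`), false over `U⁰` (`periodFree_perL44_iff`). -/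
theorem periodFree_not_liu_isoFree (h : PerLHypothesesInhabited) (M : U.ModelAxioms)
    (hL : U.periodFree.LiuSupplyPerL) {Hk : U.periodFree.HeckeData} (hI : U.periodFree.IsoFreePerL Hk) : False :=
  (U.periodFree_perL44_iff.mp (perL44_of_liu_isoFree M.periodFree hL hI)) h

/-- The same for the face binders, outright (`faceHypothesesInhabited`: `ℚ(ζ₇)`). -/
theorem periodFree_not_liu_isoFree_face (M : U.ModelAxioms) (hL : U.periodFree.LiuSupplyFace)
    {Hk : U.periodFree.HeckeData} (hI : U.periodFree.IsoFreeFace Hk) : False :=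
  (U.periodFree_periodThmF_iff.mp (periodThmF_of_liu_isoFree M.periodFree hL hI)) faceHypothesesInhabited

/-- And directly from the separation, without supply: over `U⁰` an `IsoFreePerL`-datum's obstruction clause can only
hold vacuously — every `Meets` is false (`periodFree_not_meets`), so (P♮₂) there says that no level carries two
nonzero isotypic one-forms of types `Ψ₀, Ψ₁`, i.e. it NEGATES supply. -/
theorem periodFree_freeObstruction_iff_noSupply (D : U.periodFree.IsoDatum V) {Hk : U.periodFree.HeckeData}
    (hS : D.Standard Hk) (M : U.ModelAxioms) (K : CMField) (Ψ : Fin 4 → CMType K) (σ : K →+* ℂ) :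
    D.FreeObstruction K Ψ σ ↔
      ∀ (Γ₀ Γ₁ : Level V) (ω₀ : U.periodFree.CohC (U.periodFree.pms L ι₁ V Γ₀) 1)
        (ω₁ : U.periodFree.CohC (U.periodFree.pms L ι₁ V Γ₁) 1),
        ω₀ ∈ U.periodFree.Uiso Γ₀ K (Ψ 0) σ → ω₁ ∈ U.periodFree.Uiso Γ₁ K (Ψ 1) σ → ω₀ = 0 ∨ ω₁ = 0 := by
  constructor
  · intro h Γ₀ Γ₁ ω₀ ω₁ h₀ h₁
    rcases eq_or_ne ω₀ 0 with e₀ | hne₀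
    · exact Or.inl e₀
    rcases eq_or_ne ω₁ 0 with e₁ | hne₁
    · exact Or.inr e₁
    obtain ⟨Γ', f₀, f₁, π, -, hm⟩ := h Γ₀ Γ₁ ω₀ ω₁ h₀ h₁ hne₀ hne₁
    exact absurd hm (periodFree_not_meets D hS M π K (Ψ 2) (Ψ 3) σ)
  · intro h Γ₀ Γ₁ ω₀ ω₁ h₀ h₁ hne₀ hne₁
    rcases h Γ₀ Γ₁ ω₀ ω₁ h₀ h₁ with e | e
    · exact absurd e hne₀
    · exact absurd e hne₁

end Universe

end HodgeCM

end
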